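import Mathlib
import Summits.Ventures.PercRepro2.Defs
import Summits.Ventures.PercRepro2.Harris
import Summits.Ventures.PercRepro2.Independence
import Summits.Ventures.PercRepro2.CoinDefs
import Summits.Ventures.PercRepro2.CoinReverse
import Summits.Ventures.PercRepro2.CoinStarDefs
import Summits.Ventures.PercRepro2.CoinLsmCoreDefs
import Summits.Ventures.PercRepro2.CoinLsmCoreU
import Summits.Ventures.PercRepro2.CoinCoreGate
import Summits.Ventures.PercRepro2.CoinTreeCore
import Summits.Ventures.PercRepro2.CoinOrTailAlg
import Summits.Ventures.PercRepro2.CoinOrTailDefs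
import Summits.Ventures.PercRepro2.CoinOrTailLsmDefs
import Summits.Ventures.PercRepro2.CoinOrTailLsmSums
import Summits.Ventures.PercRepro2.CoinTreeAncestor
import Summits.Ventures.PercRepro2.CoinOrTailBlockAlg
import Summits.Ventures.PercRepro2.CoinOrTailBlockSums

/-!
# Row 2′DARC at an OR-tail for DOMINATING markers — in particular BOTH MARKERS FAR ON DIFFERENT
ROUTES (blind cell PercRepro2, night-2 g9 session 2; proofs/NIGHT2-DARC.md §39)

`darc_of_orTailLsmDom`: an OR-tail on a log-supermodular core `U` (`OrTailU`, entries `r, q`,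
tail `a`), and two markers `m₁, m₂ ∈ U` that DOMINATE the entries — every cluster of `U`
containing the entry `r` contains `m₁`, every cluster containing `q` contains `m₂` (`hdom₁`,
`hdom₂`, the two `hcut` hypotheses of the one-far-marker theorem `darc_of_orTailLsm3`, now on
BOTH sides) — give `Φ_D({s ↛ t in D + (a → w)}) ≥ 0` for the markers `m₁, m₂` at every head.
Instances: the markers adjacent to the tail (`m₁ = r`, `m₂ = q`: `darc_of_orTailLsm`), one far
marker (`darc_of_orTailLsm3`, `darc_of_orTailLsm3'`), and the previously open case of both
markers far on different routes — e.g. the directed two-route core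
`s → p → r → a ← u ← q' ← s` with the markers `p, q'` (`darc_of_orTailTreeDom`).
The functional is `orTailDom_functional_nonneg` (the block theorem); the seven core sums are
the branch sums of `rVal`/`gVal` (`OrTailU.sum_R_eq`, `OrTailU.sum_G_eq`, in `CoinOrTailLsmSums`) and the head is
nonnegative, decreasing and log-supermodular (`OrTailU.head_props`); the ancestor lemma
`TreeCore.reach_iterate_par` (`CoinTreeAncestor`) gives the out-tree corollary.
-/

namespace Summit.Ventures.PercRepro2.Coin

open Classical

section OrTailDomMain

variable {V : Type*} {E : Type*} [Fintype V] [DecidableEq V] [Fintype E] [DecidableEq E]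
  {R : Type*} [Field R] [LinearOrder R] [IsStrictOrderedRing R]
  {arcs : E → Finset (V × V)} {s : V} {U : Finset V} {q a w : V} {cρ cτ : E}

/-- **THEOREM (row 2′DARC at an OR-tail for dominating markers).**  `OrTailU arcs s U r q a cρ cτ`
(entries `r, q`), `SameEnds`, the cluster law of `U` log-supermodular (`hν`), markers
`m₁, m₂ ∈ U` dominating the entries (`hdom₁ : r ∈ W → m₁ ∉ W → P(level W) = 0`,
`hdom₂ : q ∈ W → m₂ ∉ W → P(level W) = 0`), `t, w ∉ U ∪ {a, s}` ⟹
`Φ_D({s ↛ t in D + (a → w)}) ≥ 0` for the markers `m₁, m₂`. -/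
theorem darc_of_orTailLsmDom (pr : E → R) (hp : IsProbVec pr) (hS : SameEnds arcs) {r : V}
    (h : OrTailU arcs s U r q a cρ cτ) {m₁ m₂ : V} (hm₁ : m₁ ∈ U) (hm₂ : m₂ ∈ U)
    (hdom₁ : ∀ W ⊆ U, r ∈ W → m₁ ∉ W → prob pr (coreLevel arcs s U W) = 0)
    (hdom₂ : ∀ W ⊆ U, q ∈ W → m₂ ∉ W → prob pr (coreLevel arcs s U W) = 0)
    (hν : ∀ W W', W ⊆ U → W' ⊆ U →
      prob pr (coreLevel arcs s U W) * prob pr (coreLevel arcs s U W') ≤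
        prob pr (coreLevel arcs s U (W ∩ W')) * prob pr (coreLevel arcs s U (W ∪ W')))
    {t : V} (htC : t ∉ insert a U) (hts : t ≠ s) (hws : w ≠ s) (hwC : w ∉ insert a U) :
    DARC pr arcs s {t} m₁ m₂ a w := by
  have hC := h.closedInCoreU
  have hm₁a : m₁ ≠ a := fun e => h.a_notin (e ▸ hm₁)
  have hm₂a : m₂ ≠ a := fun e => h.a_notin (e ▸ hm₂)
  have hm₁C : m₁ ∈ insert a U := Finset.mem_insert_of_mem hm₁
  have hm₂C : m₂ ∈ insert a U := Finset.mem_insert_of_mem hm₂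
  have haC : a ∈ insert a U := Finset.mem_insert_self _ _
  unfold DARC
  rw [hC.phiC_gate_eq pr hS htC hts hm₁C hm₂C haC hws hwC]
  have hm1 : ∀ W : Finset V, (fun _ : Finset V => (1 : R)) (insert a W) = (fun _ => (1 : R)) W :=
    fun _ => rfl
  have hmp : ∀ W : Finset V, (fun W : Finset V => if m₁ ∈ W then (1 : R) else 0) (insert a W) =
      (fun W : Finset V => if m₁ ∈ W then (1 : R) else 0) W := by
    intro W; simp only [Finset.mem_insert, hm₁a, false_or]
  have hmq : ∀ W : Finset V, (fun W : Finset V => if m₂ ∈ W then (1 : R) else 0) (insert a W) =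
      (fun W : Finset V => if m₂ ∈ W then (1 : R) else 0) W := by
    intro W; simp only [Finset.mem_insert, hm₂a, false_or]
  have hmpq : ∀ W : Finset V,
      (fun W : Finset V => (if m₁ ∈ W then (1 : R) else 0) * (if m₂ ∈ W then (1 : R) else 0))
        (insert a W) =
      (fun W : Finset V => (if m₁ ∈ W then (1 : R) else 0) * (if m₂ ∈ W then (1 : R) else 0))
        W := by
    intro W; simp only [Finset.mem_insert, hm₁a, hm₂a, false_or]
  have eΛ := h.sum_R_eq pr t (fun _ => (1 : R)) hm1
  have eFa := h.sum_R_eq pr t (fun W => if m₁ ∈ W then (1 : R) else 0) hmp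
  have eFb := h.sum_R_eq pr t (fun W => if m₂ ∈ W then (1 : R) else 0) hmq
  have eM := h.sum_G_eq (w := w) pr t (fun _ => (1 : R)) hm1
  have eX := h.sum_G_eq (w := w) pr t (fun W => if m₁ ∈ W then (1 : R) else 0) hmp
  have eY := h.sum_G_eq (w := w) pr t (fun W => if m₂ ∈ W then (1 : R) else 0) hmq
  have eXY := h.sum_G_eq (w := w) pr t
    (fun W => (if m₁ ∈ W then (1 : R) else 0) * (if m₂ ∈ W then (1 : R) else 0)) hmpq
  simp only [mul_one] at eΛ eM
  rw [eΛ, eFa, eFb, eM, eX, eY, eXY]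
  obtain ⟨hA0, hAmono, hAlsm⟩ := OrTailU.head_props (U := U) (a := a) pr hp hS t
  exact orTailDom_functional_nonneg U (fun W => prob pr (coreLevel arcs s U W))
    (fun X => prob pr (coreAvoidEvent arcs s t (insert a U) X)) m₁ m₂ r q a w (pr cρ) (pr cτ)
    h.a_notin (fun hw => hwC (Finset.mem_insert_of_mem hw)) (hp.nonneg cρ) (hp.le_one cρ)
    (hp.nonneg cτ) (hp.le_one cτ) (fun W => prob_nonneg hp _)
    (fun s' hs' t' ht' => hν s' t' hs' ht') (fun W hW hr hm => hdom₁ W hW hr hm)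
    (fun W hW hq hm => hdom₂ W hW hq hm) hA0 hAlsm hAmono

/-- **COROLLARY (an out-tree, both markers ancestors of the two entries).**  `U` an out-tree
core (`TreeCore`), the tail entered at `r, q ∈ U`, the markers `m₁ = par^[i] r` and
`m₂ = par^[j] q` ancestors of the entries (or the entries themselves, `i = 0` / `j = 0`): row
2′DARC at `a → w` for the markers `m₁, m₂` at every head.  In particular the directed two-route
core `s → p₁ → ⋯ → p_k → a ← q_l ← ⋯ ← q₁ ← s` with ANY two markers `p_m, q_n` — both far from
the tail on DIFFERENT routes. -/
theorem darc_of_orTailTreeDom (pr : E → R) (hp : IsProbVec pr) (hS : SameEnds arcs) {r : V}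
    (h : OrTailU arcs s U r q a cρ cτ)
    {c : V → E} {par : V → V} {rk : V → ℕ} (hU : TreeCore arcs s U c par rk)
    {m₁ m₂ : V} (hm₁ : m₁ ∈ U) (hm₂ : m₂ ∈ U)
    {i : ℕ} (hi : ∀ k < i, par^[k] r ∈ U) (him : par^[i] r = m₁)
    {j : ℕ} (hj : ∀ k < j, par^[k] q ∈ U) (hjm : par^[j] q = m₂)
    {t : V} (htC : t ∉ insert a U) (hts : t ≠ s) (hws : w ≠ s) (hwC : w ∉ insert a U) :
    DARC pr arcs s {t} m₁ m₂ a w := by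
  refine darc_of_orTailLsmDom pr hp hS h hm₁ hm₂ ?_ ?_ (hU.coreLevel_lsm pr hp) htC hts hws hwC
  · intro W _ hrW hmW
    have hempty : coreLevel arcs s U W = ∅ := by
      ext ω
      simp only [Set.mem_empty_iff_false, iff_false]
      intro hω
      have hr : Reach arcs ω s r := (mem_coreLevel.mp hω r h.p_mem).mp hrW
      have hmr : Reach arcs ω s m₁ := him ▸ hU.reach_iterate_par hr i hi
      exact hmW ((mem_coreLevel.mp hω m₁ hm₁).mpr hmr)
    rw [hempty, prob_empty]
  · intro W _ hqW hmW
    have hempty : coreLevel arcs s U W = ∅ := by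
      ext ω
      simp only [Set.mem_empty_iff_false, iff_false]
      intro hω
      have hq : Reach arcs ω s q := (mem_coreLevel.mp hω q h.q_mem).mp hqW
      have hmq : Reach arcs ω s m₂ := hjm ▸ hU.reach_iterate_par hq j hj
      exact hmW ((mem_coreLevel.mp hω m₂ hm₂).mpr hmq)
    rw [hempty, prob_empty]

end OrTailDomMain

end Summit.Ventures.PercRepro2.Coin
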